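import Literature.Probability.RandomPlanarGeometry.HullUniformizer
import Mathlib.Analysis.Complex.BorelCaratheodory
import Mathlib.Topology.MetricSpace.Sequences
import HarnessLib

/-!
# Flat hulls: `im z - height(B) ≤ im Φ_B(z)`, and uniform smallness from small imaginary part

Two analytic estimates used to show that the maps `Φ_{B_δ}` of thin ("flat") hulls `B_δ`
(height `≤ δ`) converge to the identity, as needed for the smooth outer approximation of
[LSW] Lemma 2.1 (G. F. Lawler, O. Schramm, W. Werner, *Conformal restriction: the chordal case*,
JAMS 16 (2003), Lemma 2.1 p. 8 and the hulls `E_δ` of the proof of Lemma 3.5, p. 13):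

* `Literature.Probability.RandomPlanarGeometry.IsSlitHull.im_sub_height_le_im_ext` — for a one-sided hull `B ⊆ {Im ≤ h}` and its map
  `Φ_B` (`HullUniformizer`), `im z - h ≤ im Φ_B(z)` on `ℍ ∖ B` (together with
  `im Φ_B(z) ≤ im z`, `IsSlitHull.im_ext_le_im`): the maximum modulus principle for
  `exp(-i(Φ_B⁻¹(w) - w))` on truncated half-discs, the boundary values of `Φ_B⁻¹` at real
  points lying in `ℝ ∪ B ⊆ {Im ≤ h}` (a cluster-value argument), cf. the proof of
  `Complex.im_le_im_of_tendsto_sub_self`;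
* `Literature.Probability.RandomPlanarGeometry.exists_forall_norm_le_mul_of_abs_im_le` — if holomorphic `G_i` on a connected open `s`
  vanish at `z₀ ∈ s` and `|im G_i| ≤ ε_i` on `s`, then `‖G_i‖ ≤ C_K ε_i` on each compact
  `K ⊆ s` (Borel–Carathéodory on small discs, `Complex.borelCaratheodory_zero`, chained along
  `s` by `IsPreconnected.induction₂`, and compactness).
-/

noncomputable section

open Set Filter Topology Metric Bornology Complex
open UpperHalfPlane (upperHalfPlaneSet isOpen_upperHalfPlaneSet)
open scoped ComplexConjugate

namespace Literature.Probability.RandomPlanarGeometry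

/-! ### Uniform smallness from small imaginary part -/

section Smallness

variable {ι : Type*} {s : Set ℂ} {G : ι → ℂ → ℂ} {ε : ι → ℝ}

/-- **Local Borel–Carathéodory bound**: if `G` is holomorphic on `ball x (2r)` with
`|im G| ≤ e` there, then `‖G z - G x‖ ≤ 4 e` on `ball x r`. [folklore] -/
theorem norm_sub_le_of_abs_im_le {g : ℂ → ℂ} {x : ℂ} {r e : ℝ} (hr : 0 < r) (he : 0 < e)
    (hg : DifferentiableOn ℂ g (ball x (2 * r))) (him : ∀ z ∈ ball x (2 * r), |(g z).im| ≤ e)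
    {z : ℂ} (hz : z ∈ ball x r) : ‖g z - g x‖ ≤ 4 * e := by
  -- `f w = -i (g (x + w) - g x)` on `ball 0 (2r)`: `re f ≤ 2e`, `f 0 = 0`
  set f : ℂ → ℂ := fun w ↦ -I * (g (x + w) - g x) with hf
  have hmaps : ∀ w ∈ ball (0 : ℂ) (2 * r), x + w ∈ ball x (2 * r) := fun w hw ↦ by
    rw [mem_ball, dist_eq_norm, add_sub_cancel_left]
    exact mem_ball_zero_iff.1 hw
  have hfd : DifferentiableOn ℂ f (ball 0 (2 * r)) := by
    refine (differentiableOn_const _).mul ((DifferentiableOn.comp hg ?_ fun w hw ↦ hmaps w hw).sub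
      (differentiableOn_const _))
    exact (differentiableOn_const x).add differentiableOn_id
  have hx2 : x ∈ ball x (2 * r) := mem_ball_self (by linarith)
  have hf₁ : MapsTo f (ball 0 (2 * r)) {w : ℂ | w.re ≤ 2 * e} := fun w hw ↦ by
    show (f w).re ≤ 2 * e
    have h1 : (f w).re = (g (x + w)).im - (g x).im := by
      simp [hf, mul_re, sub_im]
    rw [h1]
    have := him _ (hmaps w hw)
    have := him x hx2
    linarith [le_abs_self ((g (x + w)).im), neg_abs_le ((g x).im)]
  have hf0 : f 0 = 0 := by simp [hf]
  have hw : z - x ∈ ball (0 : ℂ) (2 * r) := by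
    rw [mem_ball_zero_iff, ← dist_eq_norm]; linarith [mem_ball.1 hz]
  have hBC := Complex.borelCaratheodory_zero (M := 2 * e) (by linarith) hfd hf₁ (by linarith) hw hf0
  have hnorm : ‖f (z - x)‖ = ‖g z - g x‖ := by
    rw [hf]
    simp only [add_sub_cancel, norm_mul, norm_neg, norm_I, one_mul]
  rw [hnorm] at hBC
  have hzx : ‖z - x‖ < r := by rw [← dist_eq_norm]; exact mem_ball.1 hz
  have hden : r ≤ 2 * r - ‖z - x‖ := by linarith
  calc ‖g z - g x‖ ≤ 2 * (2 * e) * ‖z - x‖ / (2 * r - ‖z - x‖) := hBC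
    _ ≤ 2 * (2 * e) * r / r := by
        have h1 : 2 * (2 * e) * ‖z - x‖ ≤ 2 * (2 * e) * r := by nlinarith
        exact div_le_div₀ (by positivity) h1 hr hden
    _ = 4 * e := by field_simp; ring

/-- **Uniform smallness from small imaginary part.** Let `G i` be holomorphic on a preconnected
open `s` with `|im (G i)| ≤ ε i` (`ε i > 0`) on `s` and `G i z₀ = 0` at some `z₀ ∈ s`. Then for
every compact `K ⊆ s` there is `C` with `‖G i z‖ ≤ C ε i` for all `i` and `z ∈ K`
(Borel–Carathéodory locally, chained along `s`, compactness). [folklore] -/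
theorem exists_forall_norm_le_mul_of_abs_im_le (hs : IsOpen s) (hconn : IsPreconnected s)
    (hε : ∀ i, 0 < ε i) (hG : ∀ i, DifferentiableOn ℂ (G i) s)
    (him : ∀ i, ∀ z ∈ s, |(G i z).im| ≤ ε i) {z₀ : ℂ} (hz₀ : z₀ ∈ s) (h0 : ∀ i, G i z₀ = 0)
    {K : Set ℂ} (hK : IsCompact K) (hKs : K ⊆ s) :
    ∃ C : ℝ, ∀ i, ∀ z ∈ K, ‖G i z‖ ≤ C * ε i := by
  -- local radii
  have hloc : ∀ x ∈ s, ∃ r > 0, ball x (2 * r) ⊆ s := fun x hx ↦ by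
    obtain ⟨ρ, hρ, hball⟩ := Metric.isOpen_iff.1 hs x hx
    exact ⟨ρ / 2, by positivity, by rwa [show 2 * (ρ / 2) = ρ by ring]⟩
  -- the chained relation
  set P : ℂ → ℂ → Prop := fun x y ↦ ∃ C : ℝ, ∀ i, ‖G i x - G i y‖ ≤ C * ε i with hP
  have hPall : ∀ x ∈ s, ∀ y ∈ s, P x y := by
    intro x hx y hy
    refine hconn.induction₂ P (fun x hx ↦ ?_) (fun x y z _ _ _ ⟨C₁, h₁⟩ ⟨C₂, h₂⟩ ↦ ?_)
      (fun x y _ _ ⟨C, hC⟩ ↦ ⟨C, fun i ↦ by rw [norm_sub_rev]; exact hC i⟩) hx hy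
    · obtain ⟨r, hr, hball⟩ := hloc x hx
      refine mem_nhdsWithin_of_mem_nhds (Filter.mem_of_superset (ball_mem_nhds x hr) fun y hy ↦ ?_)
      refine ⟨4, fun i ↦ ?_⟩
      rw [norm_sub_rev]
      exact norm_sub_le_of_abs_im_le hr (hε i) ((hG i).mono hball) (fun z hz ↦ him i z (hball hz)) hy
    · exact ⟨C₁ + C₂, fun i ↦ by
        calc ‖G i x - G i z‖ = ‖(G i x - G i y) + (G i y - G i z)‖ := by ring_nf
          _ ≤ ‖G i x - G i y‖ + ‖G i y - G i z‖ := norm_add_le _ _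
          _ ≤ C₁ * ε i + C₂ * ε i := add_le_add (h₁ i) (h₂ i)
          _ = (C₁ + C₂) * ε i := by ring⟩
  -- local uniform bound around each point of `K`, then a finite subcover
  have hU : ∀ x ∈ K, ∃ r > 0, ball x (2 * r) ⊆ s ∧ ∃ C : ℝ, 0 ≤ C ∧ ∀ i, ∀ z ∈ ball x r, ‖G i z‖ ≤ C * ε i := by
    intro x hx
    obtain ⟨r, hr, hball⟩ := hloc x (hKs hx)
    obtain ⟨C₀, hC₀⟩ := hPall z₀ hz₀ x (hKs hx)
    refine ⟨r, hr, hball, max C₀ 0 + 4, by positivity, fun i z hz ↦ ?_⟩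
    have h1 := norm_sub_le_of_abs_im_le hr (hε i) ((hG i).mono hball) (fun z hz ↦ him i z (hball hz)) hz
    have h2 := hC₀ i
    rw [h0 i, zero_sub, norm_neg] at h2
    calc ‖G i z‖ = ‖(G i z - G i x) + G i x‖ := by ring_nf
      _ ≤ ‖G i z - G i x‖ + ‖G i x‖ := norm_add_le _ _
      _ ≤ 4 * ε i + C₀ * ε i := add_le_add h1 h2
      _ ≤ (max C₀ 0 + 4) * ε i := by nlinarith [le_max_left C₀ 0, hε i]
  choose! r hr hrs C hC0 hC using hU
  obtain ⟨t, htK, hcover⟩ := hK.elim_nhds_subcover (fun x ↦ ball x (r x)) fun x hx ↦ ball_mem_nhds x (hr x hx)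
  refine ⟨∑ x ∈ t, C x, fun i z hz ↦ ?_⟩
  obtain ⟨x, hxt, hzx⟩ := mem_iUnion₂.1 (hcover hz)
  have hxK := htK x hxt
  calc ‖G i z‖ ≤ C x * ε i := hC x hxK i z hzx
    _ ≤ (∑ y ∈ t, C y) * ε i := by
        refine mul_le_mul_of_nonneg_right ?_ (hε i).le
        exact Finset.single_le_sum (fun y hy ↦ hC0 y (htK y hy)) hxt

end Smallness

/-! ### The lower bound `im z - h ≤ im Φ_B(z)` for a hull of height `h` -/

namespace IsSlitHull

variable {B : Set ℂ} {p q : ℝ} (hB : IsSlitHull B p q)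
include hB

/-- `Φ_B⁻¹` is bounded on bounded subsets of `ℍ` (`Φ_B → ∞` at `∞`). [folklore] -/
theorem exists_forall_norm_symm_le (R : ℝ) :
    ∃ M : ℝ, ∀ w ∈ upperHalfPlaneSet, ‖w‖ ≤ R → ‖hB.restrictionMap.symm w‖ ≤ M := by
  have hinf := hB.isRestrictionMap.tendsto_cocompact
  rw [← cobounded_eq_cocompact (α := ℂ)] at hinf
  obtain ⟨M, -, hM⟩ := (Filter.hasBasis_cobounded_norm.inf_principal _).tendsto_iff
    Filter.hasBasis_cobounded_norm |>.1 hinf (R + 1) trivial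
  refine ⟨M, fun w hw hwR ↦ ?_⟩
  by_contra hlt
  push Not at hlt
  have hz := hB.symm_mem hw
  have := hM (hB.restrictionMap.symm w) ⟨hlt.le, hz⟩
  simp only [mem_setOf_eq, IsSlitHull.restrictionMap_apply, hB.ext_symm_apply hw] at this
  linarith

/-- **Boundary values of `Φ_B⁻¹` at the real axis lie in `{Im ≤ h}`** when `B ⊆ {Im ≤ h}`:
uniformly on bounded sets, `im Φ_B⁻¹(w) < h + ε` once `im w` is small (cluster values of
`Φ_B⁻¹` at real points lie in `ℝ ∪ B`). [folklore] -/
theorem exists_forall_im_symm_lt {h : ℝ} (hh : 0 ≤ h) (hBh : ∀ z ∈ B, z.im ≤ h) {ε : ℝ} (hε : 0 < ε)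
    (R : ℝ) : ∃ η > 0, ∀ w ∈ upperHalfPlaneSet, ‖w‖ ≤ R → w.im ≤ η →
      (hB.restrictionMap.symm w).im < h + ε := by
  by_contra hno
  push Not at hno
  -- a sequence `w n` with `im w n → 0`, `‖w n‖ ≤ R`, `im Ψ(w n) ≥ h + ε`
  choose w hwH hwR hwim hΨ using fun n : ℕ ↦ hno (1 / ((n : ℝ) + 1)) (by positivity)
  set Ψ := hB.restrictionMap.symm with hΨdef
  obtain ⟨M, hM⟩ := hB.exists_forall_norm_symm_le R
  have hbdd : ∀ n, Ψ (w n) ∈ closedBall (0 : ℂ) M := fun n ↦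
    mem_closedBall_zero_iff.2 (hM _ (hwH n) (hwR n))
  obtain ⟨P, -, φ, hφ, hlim⟩ := tendsto_subseq_of_bounded isBounded_closedBall hbdd
  have hPim : h + ε ≤ P.im :=
    ge_of_tendsto ((continuous_im.tendsto P).comp hlim) (Eventually.of_forall fun n ↦ hΨ (φ n))
  have hPH : 0 < P.im := by linarith
  by_cases hPB : P ∈ B
  · linarith [hBh P hPB]
  · -- `P ∈ ℍ ∖ B`: continuity of `Φ_B` at `P` forces `im w (φ n) → im Φ_B(P) > 0`
    have hPU : P ∈ upperHalfPlaneSet \ B := ⟨hPH, hPB⟩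
    have hcont : ContinuousAt hB.ext P :=
      (hB.differentiableAt_ext (hB.diff_subset_slitDomain hPU)).continuousAt
    have h1 : Tendsto (fun n ↦ hB.ext (Ψ (w (φ n)))) atTop (𝓝 (hB.ext P)) := hcont.tendsto.comp hlim
    have h2 : ∀ n, hB.ext (Ψ (w (φ n))) = w (φ n) := fun n ↦ hB.ext_symm_apply (hwH _)
    simp_rw [h2] at h1
    have h3 : Tendsto (fun n ↦ (w (φ n)).im) atTop (𝓝 (hB.ext P).im) := (continuous_im.tendsto _).comp h1
    have h4 : Tendsto (fun n ↦ (w (φ n)).im) atTop (𝓝 0) := by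
      refine squeeze_zero (fun n ↦ (le_of_lt (hwH (φ n)))) (fun n ↦ hwim (φ n)) ?_
      have : Tendsto (fun n : ℕ ↦ 1 / ((n : ℝ) + 1)) atTop (𝓝 0) := tendsto_one_div_add_atTop_nhds_zero_nat
      exact this.comp hφ.tendsto_atTop
    have := tendsto_nhds_unique h3 h4
    have hpos : 0 < (hB.ext P).im := hB.mapsTo_ext hPU
    linarith

/-- **Flat hulls do not push far down: `im z - h ≤ im Φ_B(z)`** for a one-sided hull
`B ⊆ {Im ≤ h}` and `z ∈ ℍ ∖ B`. Maximum modulus for `f(w) = exp(-i(Φ_B⁻¹(w) - w))`,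
`|f| = e^{im Φ_B⁻¹ - im w}`, on truncated half-discs `{im w > η} ∩ B(0, R)`: on the outer arc
`Φ_B⁻¹(w) - w → -L ∈ ℝ`, on the bottom edge `im Φ_B⁻¹ < h + ε` by the boundary values of
`Φ_B⁻¹`. [folklore] -/
theorem im_sub_height_le_im_ext {h : ℝ} (hh : 0 ≤ h) (hBh : ∀ z ∈ B, z.im ≤ h)
    {z : ℂ} (hz : z ∈ upperHalfPlaneSet \ B) : z.im - h ≤ (hB.ext z).im := by
  set Ψ := hB.restrictionMap.symm with hΨdef
  -- `Ψ w - w → -L`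
  obtain ⟨L, hL⟩ := hB.exists_tendsto_ext_sub
  have hΨlim : Tendsto (fun w ↦ Ψ w - w) (cocompact ℂ ⊓ 𝓟 upperHalfPlaneSet) (𝓝 (-(L : ℂ))) := by
    have h1 := hL.comp hB.tendsto_symm_cocompact
    have h2 := h1.neg
    refine h2.congr' ?_
    filter_upwards [mem_inf_of_right (mem_principal_self _)] with w hw
    have e := hB.ext_symm_apply hw
    rw [← hΨdef] at e
    simp only [Function.comp_apply, ← hΨdef]
    rw [e]
    ring
  -- it suffices to show `im Ψ w₀ - im w₀ ≤ h` at `w₀ = Φ_B z`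
  set w₀ := hB.ext z with hw₀
  have hw₀H : w₀ ∈ upperHalfPlaneSet := hB.mapsTo_ext hz
  have hΨw₀ : Ψ w₀ = z := by
    have := hB.restrictionMap.symm_apply_apply hz
    rwa [IsSlitHull.restrictionMap_apply] at this
  suffices key : (Ψ w₀).im - w₀.im ≤ h by rw [hΨw₀] at key; linarith
  -- the function `f`
  set f : ℂ → ℂ := fun w ↦ exp (-I * (Ψ w - w)) with hf
  have hnorm : ∀ w, ‖f w‖ = Real.exp ((Ψ w).im - w.im) := fun w ↦ by
    simp only [hf, norm_exp, neg_mul, neg_re, mul_re, I_re, zero_mul, I_im, one_mul, zero_sub,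
      sub_im, neg_neg]
  have hΨd : DifferentiableOn ℂ Ψ upperHalfPlaneSet := hB.restrictionMap.symm.differentiableOn_coe
  have hfd : DifferentiableOn ℂ f upperHalfPlaneSet :=
    ((differentiableOn_const _).mul (hΨd.sub differentiableOn_id)).cexp
  suffices key : ∀ ε : ℝ, 0 < ε → ‖f w₀‖ ≤ Real.exp (h + ε) by
    by_contra hlt
    rw [not_le] at hlt
    have hε : 0 < ((Ψ w₀).im - w₀.im - h) / 2 := by linarith
    have := key _ hε
    rw [hnorm, Real.exp_le_exp] at this
    linarith
  intro ε hε
  -- radius beyond which `|im (Ψ w - w)| < ε`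
  obtain ⟨R₀, hR₀⟩ : ∃ R₀ : ℝ, ∀ w ∈ upperHalfPlaneSet, R₀ < ‖w‖ → (Ψ w).im - w.im < ε := by
    have hev := hΨlim.eventually (Metric.ball_mem_nhds (-(L : ℂ)) hε)
    rw [← cobounded_eq_cocompact] at hev
    obtain ⟨R₀, -, hR⟩ := ((hasBasis_cobounded_compl_closedBall (0 : ℂ)).inf_principal _).eventually_iff.1 hev
    refine ⟨R₀, fun w hw hwR ↦ ?_⟩
    have h1 := hR ⟨by simpa using hwR, hw⟩
    rw [dist_eq_norm, sub_neg_eq_add] at h1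
    have h2 := abs_im_le_norm (Ψ w - w + (L : ℂ))
    rw [add_im, sub_im, ofReal_im, add_zero] at h2
    linarith [le_abs_self ((Ψ w).im - w.im)]
  set R : ℝ := max R₀ ‖w₀‖ + 1 with hR
  -- height below which `im Ψ < h + ε` on `‖w‖ ≤ R`
  obtain ⟨η₀, hη₀, hη₀Ψ⟩ := hB.exists_forall_im_symm_lt hh hBh hε R
  set η : ℝ := min η₀ w₀.im / 2 with hη
  have hw₀im : 0 < w₀.im := hw₀H
  have hηpos : 0 < η := by rw [hη]; positivity
  have hηη₀ : η ≤ η₀ := by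
    have := min_le_left η₀ w₀.im
    rw [hη]; linarith
  have hηw₀ : η < w₀.im := by
    have := min_le_right η₀ w₀.im
    rw [hη]; linarith
  set V : Set ℂ := {w : ℂ | η < w.im} ∩ ball 0 R with hV
  have hVH : closure V ⊆ upperHalfPlaneSet := by
    intro w hw
    have h1 : w ∈ closure {w : ℂ | η < w.im} := closure_mono inter_subset_left hw
    have h2 : η ≤ w.im := closure_lt_subset_le continuous_const continuous_im h1
    exact hηpos.trans_le h2
  have hw₀V : w₀ ∈ V := ⟨hηw₀, by
    rw [mem_ball_zero_iff, hR]; linarith [le_max_right R₀ ‖w₀‖]⟩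
  have hbdd : IsBounded V := isBounded_ball.subset inter_subset_right
  have hdc : DiffContOnCl ℂ f V :=
    ⟨hfd.mono (subset_closure.trans hVH), hfd.continuousOn.mono hVH⟩
  refine Complex.norm_le_of_forall_mem_frontier_norm_le hbdd hdc (fun w hw ↦ ?_) (subset_closure hw₀V)
  have hw' := frontier_inter_subset _ _ hw
  have hwH : w ∈ upperHalfPlaneSet := hVH (frontier_subset_closure hw)
  have hwcl : w ∈ closure (ball (0 : ℂ) R) := closure_mono inter_subset_right (frontier_subset_closure hw)
  have hwR : ‖w‖ ≤ R := by
    rw [closure_ball 0 (by rw [hR]; positivity)] at hwcl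
    exact mem_closedBall_zero_iff.1 hwcl
  rcases hw' with ⟨h1, -⟩ | ⟨-, h2⟩
  · -- bottom edge `im w = η`
    have him : w.im = η := (frontier_lt_subset_eq continuous_const continuous_im h1 : η = w.im).symm
    have hlt := hη₀Ψ w hwH hwR (by rw [him]; exact hηη₀)
    rw [hnorm, Real.exp_le_exp, him]
    linarith
  · -- outer arc `‖w‖ = R`
    have hwR' : ‖w‖ = R := by simpa using frontier_ball_subset_sphere h2
    have hR₀w : R₀ < ‖w‖ := by rw [hwR', hR]; linarith [le_max_left R₀ ‖w₀‖]
    have hlt := hR₀ w hwH hR₀w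
    rw [hnorm, Real.exp_le_exp]
    linarith

end IsSlitHull

/-! ### The stadium hulls `D_δ` over a real segment -/

section Stadium

variable {a b δ : ℝ}

/-- **The closed stadium `D_δ([a, b])`** of [LSW]'s proof of Lemma 3.5 (p. 13: "let `D_δ` be
the set of points in `ℍ` with distance at most `δ` from `[Φ_A(x₀), Φ_A(x₁)]`"), here closed in
`ℍ̄`: the points of the closed upper half-plane within `δ` of the real segment `[a, b]`.
[cite: LawlerSchrammWerner2003Restriction, proof of Lemma 3.5 (p. 13, the sets D_δ)] -/
def stadium (a b δ : ℝ) : Set ℂ := {z : ℂ | 0 ≤ z.im ∧ infDist z (realSeg a b) ≤ δ}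

/-- The real segment is nonempty. [folklore] -/
theorem realSeg_nonempty (a b : ℝ) : (realSeg a b).Nonempty := ⟨a, ofReal_mem_realSeg.2 left_mem_uIcc⟩

/-- Distance to a set of reals is at least `|im|`. [folklore] -/
theorem abs_im_le_infDist_realSeg (z : ℂ) : |z.im| ≤ infDist z (realSeg a b) := by
  refine (le_infDist (realSeg_nonempty a b)).2 fun y hy ↦ ?_
  have hyim := im_eq_zero_of_mem_realSeg hy
  have := abs_im_le_norm (z - y)
  rw [sub_im, hyim, sub_zero] at this
  rwa [dist_eq_norm]

/-- The stadium has height `δ`. [folklore] -/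
theorem im_le_of_mem_stadium {z : ℂ} (hz : z ∈ stadium a b δ) : z.im ≤ δ :=
  (le_abs_self _).trans ((abs_im_le_infDist_realSeg z).trans hz.2)

/-- The stadium is closed. [folklore] -/
theorem isClosed_stadium : IsClosed (stadium a b δ) :=
  (isClosed_le continuous_const continuous_im).inter
    (isClosed_le (continuous_infDist_pt _) continuous_const)

/-- Real points of the stadium lie in `[a - δ, b + δ]` (for `a ≤ b`). [folklore] -/
theorem mem_Icc_of_ofReal_mem_stadium (hab : a ≤ b) {x : ℝ} (hx : (x : ℂ) ∈ stadium a b δ) :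
    x ∈ Icc (a - δ) (b + δ) := by
  have key : ∀ y ∈ realSeg a b, a - x ≤ dist (x : ℂ) y ∧ x - b ≤ dist (x : ℂ) y := by
    intro y hy
    obtain ⟨t, ht, rfl⟩ := hy
    rw [uIcc_of_le hab] at ht
    rw [dist_eq_norm, ← ofReal_sub, norm_real, Real.norm_eq_abs]
    constructor
    · linarith [neg_abs_le (x - t), ht.1]
    · linarith [le_abs_self (x - t), ht.2]
  have h1 : a - x ≤ infDist (x : ℂ) (realSeg a b) :=
    (le_infDist (realSeg_nonempty a b)).2 fun y hy ↦ (key y hy).1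
  have h2 : x - b ≤ infDist (x : ℂ) (realSeg a b) :=
    (le_infDist (realSeg_nonempty a b)).2 fun y hy ↦ (key y hy).2
  exact ⟨by linarith [hx.2], by linarith [hx.2]⟩

/-- The stadium is bounded. [folklore] -/
theorem isBounded_stadium (hab : a ≤ b) : IsBounded (stadium a b δ) := by
  refine isBounded_iff_forall_norm_le.2 ⟨|a| + |b| + δ + 1, fun z hz ↦ ?_⟩
  obtain ⟨y, hy, hzy⟩ := (infDist_lt_iff (realSeg_nonempty a b)).1
    (show infDist z (realSeg a b) < δ + 1 by linarith [hz.2])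
  obtain ⟨t, ht, rfl⟩ := hy
  rw [uIcc_of_le hab] at ht
  have hty : ‖((t : ℝ) : ℂ)‖ ≤ |a| + |b| := by
    rw [norm_real, Real.norm_eq_abs]
    rcases le_or_gt 0 t with h0 | h0
    · rw [abs_of_nonneg h0]; linarith [ht.2, le_abs_self b, abs_nonneg a]
    · rw [abs_of_neg h0]; linarith [ht.1, neg_abs_le a, abs_nonneg b]
  calc ‖z‖ = ‖(z - t) + t‖ := by rw [sub_add_cancel]
    _ ≤ ‖z - t‖ + ‖((t : ℝ) : ℂ)‖ := norm_add_le _ _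
    _ ≤ (δ + 1) + (|a| + |b|) := by rw [← dist_eq_norm]; linarith
    _ = |a| + |b| + δ + 1 := by ring

/-- `0 ∉ D_δ` when `δ < a`. [folklore] -/
theorem zero_notMem_stadium (hab : a ≤ b) (hδa : δ < a) : (0 : ℂ) ∉ stadium a b δ := fun h0 ↦ by
  have := mem_Icc_of_ofReal_mem_stadium hab (x := 0) (by simpa using h0)
  linarith [this.1]

/-- The segment lies in the stadium. [folklore] -/
theorem realSeg_subset_stadium (hδ : 0 ≤ δ) : realSeg a b ⊆ stadium a b δ := fun z hz ↦
  ⟨(im_eq_zero_of_mem_realSeg hz).symm.le, by rw [infDist_zero_of_mem hz]; exact hδ⟩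

/-- Moving vertically away from the real axis does not decrease the distance to a set of reals. [folklore] -/
theorem infDist_le_infDist_add_mul_I {z : ℂ} (hz : 0 ≤ z.im) {t : ℝ} (ht : 0 ≤ t) :
    infDist z (realSeg a b) ≤ infDist (z + t * I) (realSeg a b) := by
  refine (le_infDist (realSeg_nonempty a b)).2 fun y hy ↦ (infDist_le_dist_of_mem hy).trans ?_
  have hyim := im_eq_zero_of_mem_realSeg hy
  rw [dist_eq_norm, dist_eq_norm]
  have h1 : ‖z - y‖ ^ 2 ≤ ‖z + t * I - y‖ ^ 2 := by
    rw [← normSq_eq_norm_sq, ← normSq_eq_norm_sq, normSq_apply, normSq_apply]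
    simp only [sub_re, add_re, mul_re, ofReal_re, I_re, mul_zero, ofReal_im, I_im, mul_one, sub_self,
      add_zero, sub_im, add_im, mul_im, hyim, sub_zero]
    nlinarith
  nlinarith [norm_nonneg (z - y), norm_nonneg (z + t * I - y)]

/-- Points of `ℍ ∖ D_δ` stay outside `D_δ` when moved up. [folklore] -/
theorem add_mul_I_notMem_stadium {z : ℂ} (hz : 0 < z.im) (hzD : z ∉ stadium a b δ) {t : ℝ}
    (ht : 0 ≤ t) : z + t * I ∉ stadium a b δ := fun h ↦ by
  have h1 : δ < infDist z (realSeg a b) := by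
    by_contra hle
    exact hzD ⟨hz.le, not_lt.1 hle⟩
  have h2 := infDist_le_infDist_add_mul_I (a := a) (b := b) hz.le ht
  linarith [h.2]

/-- Points above height `δ` are not in `D_δ`. [folklore] -/
theorem notMem_stadium_of_lt_im {z : ℂ} (hz : δ < z.im) : z ∉ stadium a b δ := fun h ↦
  absurd (im_le_of_mem_stadium h) (not_le.2 hz)

/-- Vertical segments `[z, z + t i]` (`t ≥ 0`) lie in a set containing all `z + s i`, `0 ≤ s ≤ t`. [folklore] -/
theorem segment_vertical_subset {U : Set ℂ} {z : ℂ} {t : ℝ} (ht : 0 ≤ t)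
    (hU : ∀ s : ℝ, 0 ≤ s → s ≤ t → z + s * I ∈ U) : segment ℝ z (z + t * I) ⊆ U := by
  rintro w ⟨c, d, hc, hd, hcd, rfl⟩
  have : c • z + d • (z + t * I) = z + ((d * t : ℝ) : ℂ) * I := by
    rw [show c = 1 - d by linarith]
    simp only [Complex.real_smul]
    push_cast
    ring
  rw [this]
  exact hU (d * t) (by positivity) (by nlinarith)

/-- The imaginary part is constant along a horizontal segment. [folklore] -/
theorem im_eq_of_mem_segment {z w v : ℂ} (hzw : z.im = w.im) (hv : v ∈ segment ℝ z w) : v.im = z.im := by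
  obtain ⟨c, d, hc, hd, hcd, rfl⟩ := hv
  simp only [add_im, Complex.real_smul, mul_im, ofReal_re, ofReal_im, zero_mul, add_zero, ← hzw]
  rw [← add_mul, hcd, one_mul]

/-- **`ℍ ∖ D_δ` is path connected** (go up, across above height `δ`, and down). [folklore] -/
theorem isPathConnected_diff_stadium (hδ : 0 ≤ δ) :
    IsPathConnected (upperHalfPlaneSet \ stadium a b δ) := by
  set U := upperHalfPlaneSet \ stadium a b δ with hU
  set H : ℝ := δ + 1 with hH
  have hup : ∀ z ∈ U, JoinedIn U z (z + ((H : ℝ) : ℂ) * I) := fun z hz ↦ by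
    refine JoinedIn.of_segment_subset (segment_vertical_subset (by rw [hH]; linarith) fun s hs _ ↦ ?_)
    have hzim : 0 < z.im := hz.1
    exact ⟨show 0 < (z + s * I).im by simp; linarith, add_mul_I_notMem_stadium hzim hz.2 hs⟩
  have hhor : ∀ z w : ℂ, δ < z.im → z.im = w.im → JoinedIn U z w := fun z w hz hzw ↦ by
    refine JoinedIn.of_segment_subset fun v hv ↦ ?_
    have hvim : v.im = z.im := im_eq_of_mem_segment hzw hv
    exact ⟨show 0 < v.im by rw [hvim]; linarith, notMem_stadium_of_lt_im (by rw [hvim]; exact hz)⟩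
  have hpt : ((H : ℝ) : ℂ) * I ∈ U :=
    ⟨show 0 < (((H : ℝ) : ℂ) * I).im by simp [hH]; linarith,
      notMem_stadium_of_lt_im (by simp [hH])⟩
  refine ⟨_, hpt, fun z hz ↦ ?_⟩
  have hzim : 0 < z.im := hz.1
  have h1 : JoinedIn U (((H : ℝ) : ℂ) * I) (((H : ℝ) : ℂ) * I + ((z.im : ℝ) : ℂ) * I) := by
    refine JoinedIn.of_segment_subset (segment_vertical_subset hzim.le fun s hs _ ↦ ?_)
    have him : ((((H : ℝ) : ℂ)) * I + s * I).im = H + s := by simp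
    refine ⟨?_, notMem_stadium_of_lt_im (by rw [him, hH]; linarith)⟩
    show 0 < ((((H : ℝ) : ℂ)) * I + s * I).im
    rw [him, hH]; linarith
  have h2 : JoinedIn U (((H : ℝ) : ℂ) * I + ((z.im : ℝ) : ℂ) * I) (z + ((H : ℝ) : ℂ) * I) :=
    hhor _ _ (by simp [hH]; linarith) (by simp [add_comm])
  exact (h1.trans h2).trans (hup z hz).symm

/-- **`D_δ ∪ {Im ≤ 0}` is connected**: each point of the stadium is joined to a nearest point of
the segment by a segment inside the stadium. [folklore] -/
theorem isConnected_stadium_union (hδ : 0 ≤ δ) :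
    IsConnected (stadium a b δ ∪ {z : ℂ | z.im ≤ 0}) := by
  set L : Set ℂ := {z : ℂ | z.im ≤ 0} with hL
  have hLc : IsPreconnected L := (convex_halfSpace_im_le 0).isPreconnected
  have hSc : IsCompact (realSeg a b) := isCompact_realSeg
  refine ⟨⟨0, Or.inr (by simp [hL])⟩, ?_⟩
  choose y hy hzy using fun z : stadium a b δ ↦ hSc.exists_infDist_eq_dist (realSeg_nonempty a b) (z : ℂ)
  have hseg : ∀ z : stadium a b δ, segment ℝ (z : ℂ) (y z) ⊆ stadium a b δ := by
    rintro z w ⟨c, d, hc, hd, hcd, rfl⟩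
    have hyim := im_eq_zero_of_mem_realSeg (hy z)
    refine ⟨by
      simp only [add_im, Complex.real_smul, mul_im, ofReal_re, ofReal_im, zero_mul, add_zero, hyim, mul_zero]
      nlinarith [z.2.1], (infDist_le_dist_of_mem (hy z)).trans ?_⟩
    have heq : c • (z : ℂ) + d • y z - y z = c • ((z : ℂ) - y z) := by
      rw [show d = 1 - c by linarith, smul_sub, sub_smul, one_smul]
      abel
    rw [dist_eq_norm, heq, norm_smul, Real.norm_of_nonneg hc, ← dist_eq_norm, ← hzy z]
    nlinarith [z.2.2, infDist_nonneg (x := (z : ℂ)) (s := realSeg a b)]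
  have heq : stadium a b δ ∪ L = L ∪ ⋃ z : stadium a b δ, (segment ℝ (z : ℂ) (y z) ∪ L) := by
    refine Subset.antisymm ?_ (union_subset subset_union_right (iUnion_subset fun z ↦
      union_subset ((hseg z).trans subset_union_left) subset_union_right))
    rintro w (hw | hw)
    · exact Or.inr (mem_iUnion.2 ⟨⟨w, hw⟩, Or.inl (left_mem_segment _ _ _)⟩)
    · exact Or.inl hw
  rw [heq]
  rcases isEmpty_or_nonempty (stadium a b δ) with he | hne
  · rw [iUnion_of_empty, union_empty]; exact hLc
  refine hLc.union (0 : ℂ) (by simp [hL]) (mem_iUnion.2 ⟨Classical.arbitrary _, Or.inr (by simp [hL])⟩) ?_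
  refine isPreconnected_iUnion ⟨0, mem_iInter.2 fun z ↦ Or.inr (by simp [hL])⟩ fun z ↦ ?_
  exact (convex_segment _ _).isPreconnected.union' ⟨y z, right_mem_segment _ _ _,
    le_of_eq (im_eq_zero_of_mem_realSeg (hy z))⟩ hLc

/-- **`ℍ ∖ D_δ` is simply connected.** [folklore] -/
theorem isSimplyConnected_diff_stadium (hδ : 0 ≤ δ) :
    IsSimplyConnected (upperHalfPlaneSet \ stadium a b δ) := by
  have hcompl : (upperHalfPlaneSet \ stadium a b δ)ᶜ = stadium a b δ ∪ {z : ℂ | z.im ≤ 0} := by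
    ext z
    rw [mem_compl_iff, Set.mem_sdiff, mem_union, not_and, not_not]
    constructor
    · intro h
      by_cases hz : (0 : ℝ) < z.im
      · exact Or.inl (h hz)
      · exact Or.inr (not_lt.1 hz)
    · rintro (h | h)
      · exact fun _ ↦ h
      · exact fun hz ↦ absurd (show (0 : ℝ) < z.im from hz) (not_lt.2 h)
  refine Complex.isSimplyConnected_of_compl (isOpen_upperHalfPlaneSet.sdiff isClosed_stadium)
    (isPathConnected_diff_stadium hδ).isConnected fun c hc hb ↦ ?_
  rw [hcompl] at hc hb
  have hsub : {z : ℂ | z.im ≤ 0} ⊆ connectedComponentIn (stadium a b δ ∪ {z : ℂ | z.im ≤ 0}) c :=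
    subset_union_right.trans ((isConnected_stadium_union hδ).isPreconnected.subset_connectedComponentIn
      hc subset_rfl)
  obtain ⟨R, hR⟩ := (hb.subset hsub).subset_closedBall 0
  have hmem : (-((|R| + 1 : ℝ) : ℂ) * I) ∈ {z : ℂ | z.im ≤ 0} := by
    show (-((|R| + 1 : ℝ) : ℂ) * I).im ≤ 0
    simp only [neg_mul, neg_im, mul_im, ofReal_re, I_im, mul_one, ofReal_im, I_re, mul_zero, add_zero]
    linarith [abs_nonneg R]
  have := hR hmem
  rw [mem_closedBall_zero_iff, norm_mul, norm_neg, norm_real, norm_I, mul_one,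
    Real.norm_of_nonneg (by positivity)] at this
  linarith [le_abs_self R]

/-- **`D_δ = cl(D_δ ∩ ℍ)`**: a real point of the stadium is approached vertically if it lies on
the segment, and along a small circle about its nearest point of the segment otherwise. [folklore] -/
theorem closure_stadium_inter (hδ : 0 < δ) :
    closure (stadium a b δ ∩ upperHalfPlaneSet) = stadium a b δ := by
  refine Subset.antisymm (closure_minimal inter_subset_left isClosed_stadium) fun z hz ↦ ?_
  rcases hz.1.lt_or_eq with hlt | heq
  · exact subset_closure ⟨hz, hlt⟩
  have hzim : z.im = 0 := heq.symm
  by_cases hzS : z ∈ realSeg a b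
  · -- vertical approach `z + t i`, `t ↓ 0`
    have hpath : Tendsto (fun t : ℝ ↦ z + t * I) (𝓝[>] 0) (𝓝 z) := by
      have : Continuous fun t : ℝ ↦ z + t * I := by fun_prop
      simpa using (this.tendsto 0).mono_left nhdsWithin_le_nhds
    refine mem_closure_of_tendsto hpath ?_
    have hev : ∀ᶠ t : ℝ in 𝓝[>] 0, t < δ := nhdsWithin_le_nhds (Iio_mem_nhds hδ)
    filter_upwards [self_mem_nhdsWithin, hev] with t ht htδ
    have him : (z + t * I).im = t := by simp [hzim]
    refine ⟨⟨by rw [him]; exact le_of_lt ht, (infDist_le_dist_of_mem hzS).trans ?_⟩, show 0 < (z + t * I).im by rw [him]; exact ht⟩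
    rw [dist_eq_norm, add_sub_cancel_left, norm_mul, norm_real, norm_I, mul_one, Real.norm_of_nonneg ht.le]
    exact htδ.le
  · -- circular approach about a nearest point `y`
    obtain ⟨y, hy, hzy⟩ := (isCompact_realSeg (p := a) (q := b)).exists_infDist_eq_dist (realSeg_nonempty a b) z
    have hyim := im_eq_zero_of_mem_realSeg hy
    set d : ℝ := dist z y with hd
    have hd0 : 0 < d := dist_pos.2 fun h ↦ hzS (h ▸ hy)
    have hdδ : d ≤ δ := by rw [← hzy]; exact hz.2
    set r : ℝ := (z - y).re with hr
    have hzyre : z - y = (r : ℂ) := Complex.ext (by simp [hr]) (by simp [hzim, hyim])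
    have hdr : d = |r| := by rw [hd, dist_eq_norm, hzyre, norm_real, Real.norm_eq_abs]
    set w : ℝ → ℂ := fun t ↦ y + ((r * Real.cos t : ℝ) : ℂ) + ((d * Real.sin t : ℝ) : ℂ) * I with hw
    have hpath : Tendsto w (𝓝[>] 0) (𝓝 z) := by
      have hc : Continuous w := by rw [hw]; fun_prop
      have hw0 : w 0 = z := by
        rw [hw]
        simp only [Real.cos_zero, mul_one, Real.sin_zero, mul_zero, ofReal_zero, zero_mul, add_zero]
        rw [← hzyre]; ring
      have := hc.tendsto 0
      rw [hw0] at this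
      exact this.mono_left nhdsWithin_le_nhds
    refine mem_closure_of_tendsto hpath ?_
    have hev : ∀ᶠ t : ℝ in 𝓝[>] 0, t < Real.pi := nhdsWithin_le_nhds (Iio_mem_nhds Real.pi_pos)
    filter_upwards [self_mem_nhdsWithin, hev] with t ht htπ
    have hsin : 0 < Real.sin t := Real.sin_pos_of_pos_of_lt_pi ht htπ
    have hwim : (w t).im = d * Real.sin t := by
      simp only [hw, add_im, ofReal_im, mul_im, ofReal_re, I_im, mul_one, I_re, mul_zero, add_zero, hyim,
        zero_add]
    have hwpos : 0 < (w t).im := by rw [hwim]; positivity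
    have hwdist : dist (w t) y = d := by
      rw [dist_eq_norm, hw, show y + ((r * Real.cos t : ℝ) : ℂ) + ((d * Real.sin t : ℝ) : ℂ) * I - y =
        ((r * Real.cos t : ℝ) : ℂ) + ((d * Real.sin t : ℝ) : ℂ) * I by ring, Complex.norm_add_mul_I, hdr]
      rw [show (r * Real.cos t) ^ 2 + (|r| * Real.sin t) ^ 2 = |r| ^ 2 by
        rw [mul_pow, mul_pow, sq_abs]; nlinarith [Real.sin_sq_add_cos_sq t]]
      exact Real.sqrt_sq (abs_nonneg r)
    exact ⟨⟨hwpos.le, (infDist_le_dist_of_mem hy).trans (by rw [hwdist]; exact hdδ)⟩, hwpos⟩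

/-- **The stadium `D_δ([a, b])` is a one-sided hull** with slit data `(a - 2δ, b + δ)`, for
`0 < 2δ < a`, `a ≤ b`. [folklore] -/
theorem isSlitHull_stadium (hab : a ≤ b) (hδ : 0 < δ) (hδa : 2 * δ < a) :
    IsSlitHull (stadium a b δ) (a - 2 * δ) (b + δ) := by
  have hI : uIcc (a - 2 * δ) (b + δ) = Icc (a - 2 * δ) (b + δ) := uIcc_of_le (by linarith)
  refine ⟨⟨⟨isBounded_stadium hab, closure_stadium_inter hδ, isSimplyConnected_diff_stadium hδ.le⟩,
    zero_notMem_stadium hab (by linarith)⟩, ⟨a, realSeg_subset_stadium hδ.le (ofReal_mem_realSeg.2 left_mem_uIcc)⟩,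
    isConnected_stadium_union hδ.le, ?_, fun x hx ↦ ?_⟩
  · rw [hI]; exact fun h ↦ by linarith [h.1]
  · have := mem_Icc_of_ofReal_mem_stadium hab hx
    rw [hI]
    exact ⟨⟨by linarith [this.1], this.2⟩, fun h ↦ by linarith [this.1]⟩

/-- The slit data of `D_δ` are... the segment `[a - 2δ, b + δ]`: a point at distance `> 2δ` from
`[a, b]` lies in the slit domain of `D_δ`. [folklore] -/
theorem mem_slitDomain_stadium (hab : a ≤ b) (hδ : 0 < δ) (hδa : 2 * δ < a) {z : ℂ}
    (hz : 2 * δ < infDist z (realSeg a b)) : z ∈ slitDomain (stadium a b δ) (a - 2 * δ) (b + δ) := by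
  have h := isSlitHull_stadium hab hδ hδa
  rcases lt_trichotomy z.im 0 with hlt | heq | hgt
  · rw [h.mem_slitDomain_iff_of_im_neg hlt]
    rintro ⟨-, hd⟩
    have : infDist (conj z) (realSeg a b) = infDist z (realSeg a b) := by
      have h1 : ∀ w : ℂ, infDist (conj w) (realSeg a b) ≤ infDist w (realSeg a b) := fun w ↦ by
        refine (le_infDist (realSeg_nonempty a b)).2 fun y hy ↦ ?_
        have hcy : conj y = y := conj_eq_iff_im.2 (im_eq_zero_of_mem_realSeg hy)
        calc infDist (conj w) (realSeg a b) ≤ dist (conj w) (conj y) :=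
              infDist_le_dist_of_mem (by rw [hcy]; exact hy)
          _ = dist w y := dist_conj_conj w y
      refine le_antisymm (h1 z) ?_
      simpa using h1 (conj z)
    linarith
  · have hzre : ((z.re : ℝ) : ℂ) = z := Complex.ext (by simp) (by simp [heq])
    rw [← hzre, h.ofReal_mem_slitDomain_iff, uIcc_of_le (by linarith)]
    intro hx
    rw [← hzre] at hz
    -- distance from a real `x ∈ [a - 2δ, b + δ]` to `[a, b]` is `≤ 2δ`
    have hle : infDist ((z.re : ℝ) : ℂ) (realSeg a b) ≤ 2 * δ := by
      set x := z.re
      have hproj : ((max a (min b x) : ℝ) : ℂ) ∈ realSeg a b := by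
        refine ofReal_mem_realSeg.2 ?_
        rw [uIcc_of_le hab]
        exact ⟨le_max_left _ _, max_le hab (min_le_left _ _)⟩
      refine (infDist_le_dist_of_mem hproj).trans ?_
      rw [dist_eq_norm, ← ofReal_sub, norm_real, Real.norm_eq_abs]
      rcases le_total x a with hxa | hxa
      · rw [min_eq_right (hxa.trans hab), max_eq_left hxa, abs_of_nonpos (by linarith)]; linarith [hx.1]
      · rcases le_total x b with hxb | hxb
        · rw [min_eq_right hxb, max_eq_right hxa, sub_self, abs_zero]; positivity
        · rw [min_eq_left hxb, max_eq_right hab, abs_of_nonneg (by linarith)]; linarith [hx.2]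
    linarith
  · rw [h.mem_slitDomain_iff_of_im_pos hgt]
    exact fun hzD ↦ by linarith [hzD.2]

/-- The distance to the real segment is symmetric under conjugation. [folklore] -/
theorem infDist_conj_realSeg (w : ℂ) : infDist (conj w) (realSeg a b) = infDist w (realSeg a b) := by
  have h1 : ∀ w : ℂ, infDist (conj w) (realSeg a b) ≤ infDist w (realSeg a b) := fun w ↦ by
    refine (le_infDist (realSeg_nonempty a b)).2 fun y hy ↦ ?_
    have hcy : conj y = y := conj_eq_iff_im.2 (im_eq_zero_of_mem_realSeg hy)
    calc infDist (conj w) (realSeg a b) ≤ dist (conj w) (conj y) :=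
          infDist_le_dist_of_mem (by rw [hcy]; exact hy)
      _ = dist w y := dist_conj_conj w y
  refine le_antisymm (h1 w) ?_
  simpa using h1 (conj w)

/-- `infDist 0 [a, b] ≥ a` for `0 ≤ a ≤ b`. [folklore] -/
theorem le_infDist_zero_realSeg (ha : 0 ≤ a) (hab : a ≤ b) : a ≤ infDist (0 : ℂ) (realSeg a b) := by
  refine (le_infDist (realSeg_nonempty a b)).2 fun y hy ↦ ?_
  obtain ⟨t, ht, rfl⟩ := hy
  rw [uIcc_of_le hab] at ht
  rw [dist_eq_norm, zero_sub, norm_neg, norm_real, Real.norm_eq_abs, abs_of_nonneg (ha.trans ht.1)]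
  exact ht.1

/-- Far-right real points are far from the segment: `re z - b ≤ infDist z [a, b]`. [folklore] -/
theorem re_sub_le_infDist_realSeg (hab : a ≤ b) (z : ℂ) : z.re - b ≤ infDist z (realSeg a b) := by
  refine (le_infDist (realSeg_nonempty a b)).2 fun y hy ↦ ?_
  obtain ⟨t, ht, rfl⟩ := hy
  rw [uIcc_of_le hab] at ht
  have := abs_re_le_norm (z - t)
  rw [sub_re, ofReal_re] at this
  rw [dist_eq_norm]
  linarith [le_abs_self (z.re - t), ht.2]

/-- **The complement of a neighbourhood of the segment is path connected**: the open set
`{z : η < infDist z [a, b]}`. [folklore] -/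
theorem isPathConnected_setOf_lt_infDist_realSeg (hab : a ≤ b) {η : ℝ} (hη : 0 ≤ η) :
    IsPathConnected {z : ℂ | η < infDist z (realSeg a b)} := by
  set s := {z : ℂ | η < infDist z (realSeg a b)} with hs
  set P : ℂ := ((b + η + 1 : ℝ) : ℂ) with hP
  -- the vertical line through `P` lies in `s`
  have hline : ∀ t : ℝ, P + t * I ∈ s := fun t ↦ by
    show η < infDist (P + t * I) (realSeg a b)
    have := re_sub_le_infDist_realSeg hab (P + t * I)
    have hre : (P + t * I).re = b + η + 1 := by simp [hP]
    linarith
  have hPs : P ∈ s := by simpa using hline 0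
  -- horizontal segments at `|height| > η` lie in `s`
  have hhor : ∀ z w : ℂ, η < |z.im| → z.im = w.im → segment ℝ z w ⊆ s := fun z w hz hzw v hv ↦ by
    show η < infDist v (realSeg a b)
    have hvim : v.im = z.im := im_eq_of_mem_segment hzw hv
    have := abs_im_le_infDist_realSeg (a := a) (b := b) v
    rw [hvim] at this
    linarith
  -- vertical moves away from the axis stay in `s`
  have hup : ∀ z ∈ s, 0 ≤ z.im → ∀ t : ℝ, 0 ≤ t → z + t * I ∈ s := fun z hz hzim t ht ↦ by
    show η < infDist (z + t * I) (realSeg a b)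
    exact lt_of_lt_of_le hz (infDist_le_infDist_add_mul_I hzim ht)
  have hdown : ∀ z ∈ s, z.im ≤ 0 → ∀ t : ℝ, 0 ≤ t → z - t * I ∈ s := fun z hz hzim t ht ↦ by
    show η < infDist (z - t * I) (realSeg a b)
    have h1 : conj (z - t * I) = conj z + t * I := by
      simp [map_sub, map_mul, conj_ofReal, conj_I]
    rw [← infDist_conj_realSeg, h1]
    have hcz : conj z ∈ s := by show η < _; rw [infDist_conj_realSeg]; exact hz
    exact hup _ hcz (by rw [conj_im]; linarith) t ht
  refine ⟨P, hPs, fun z hz ↦ ?_⟩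
  rcases le_or_gt 0 z.im with hzim | hzim
  · -- up, across, down
    set h : ℝ := z.im + η + 1 with hh
    have h1 : JoinedIn s z (z + ((η + 1 : ℝ) : ℂ) * I) :=
      JoinedIn.of_segment_subset (segment_vertical_subset (by linarith) fun t ht _ ↦ hup z hz hzim t ht)
    have h2 : JoinedIn s (z + ((η + 1 : ℝ) : ℂ) * I) (P + (h : ℂ) * I) := by
      refine JoinedIn.of_segment_subset (hhor _ _ ?_ ?_)
      · simp only [add_im, mul_im, ofReal_re, I_im, mul_one, ofReal_im, I_re, mul_zero, add_zero]
        rw [abs_of_nonneg (by linarith)]; linarith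
      · simp [hP, hh]; ring
    have h3 : JoinedIn s P (P + (h : ℂ) * I) :=
      JoinedIn.of_segment_subset (segment_vertical_subset (by rw [hh]; linarith) fun t _ _ ↦ hline t)
    exact ((h1.trans h2).trans h3.symm).symm
  · -- down, across, up
    set h : ℝ := -z.im + η + 1 with hh
    have h1 : JoinedIn s z (z - ((η + 1 : ℝ) : ℂ) * I) := by
      have : z - ((η + 1 : ℝ) : ℂ) * I = z + ((-(η + 1) : ℝ) : ℂ) * I := by push_cast; ring
      rw [this]
      refine JoinedIn.of_segment_subset ?_
      rintro v ⟨c, d, hc, hd, hcd, rfl⟩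
      have : c • z + d • (z + ((-(η + 1) : ℝ) : ℂ) * I) = z - ((d * (η + 1) : ℝ) : ℂ) * I := by
        rw [show c = 1 - d by linarith]
        simp only [Complex.real_smul]
        push_cast
        ring
      rw [this]
      exact hdown z hz hzim.le _ (by positivity)
    have h2 : JoinedIn s (z - ((η + 1 : ℝ) : ℂ) * I) (P - (h : ℂ) * I) := by
      refine JoinedIn.of_segment_subset (hhor _ _ ?_ ?_)
      · simp only [sub_im, mul_im, ofReal_re, I_im, mul_one, ofReal_im, I_re, mul_zero, add_zero]
        rw [abs_of_neg (by linarith)]; linarith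
      · simp [hP, hh]; ring
    have h3 : JoinedIn s P (P - (h : ℂ) * I) := by
      have : P - (h : ℂ) * I = P + ((-h : ℝ) : ℂ) * I := by push_cast; ring
      rw [this]
      refine JoinedIn.of_segment_subset ?_
      rintro v ⟨c, d, hc, hd, hcd, rfl⟩
      have : c • P + d • (P + ((-h : ℝ) : ℂ) * I) = P + ((-(d * h) : ℝ) : ℂ) * I := by
        rw [show c = 1 - d by linarith]
        simp only [Complex.real_smul]
        push_cast
        ring
      rw [this]
      exact hline _
    exact ((h1.trans h2).trans h3.symm).symm

/-- **Flat stadium hulls have maps close to the identity.** For `0 < a ≤ b` and a compact `K`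
missing the segment `[a, b]` there are `C` and `δ₀ > 0` such that for `0 < δ < δ₀` the symmetric
extension `E_δ` of `Φ_{D_δ([a,b])}` satisfies `‖E_δ(z) - z‖ ≤ C δ` on `K`: on the connected open
`{η < infDist(·, [a,b])} ∋ 0` the holomorphic `E_δ - id` vanishes at `0` and has
`|im| ≤ δ` (`im z - δ ≤ im E_δ ≤ im z` on `ℍ`, symmetry below), so
`exists_forall_norm_le_mul_of_abs_im_le` applies. This is the convergence `Φ_{D_δ} → id`,
uniformly on compacts off the segment, behind `E_δ → A` in [LSW]'s proof of Lemma 3.5.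
[cite: LawlerSchrammWerner2003Restriction, proof of Lemma 3.5 (p. 13, E_δ → A)] -/
theorem exists_forall_norm_stadium_ext_sub_le (ha : 0 < a) (hab : a ≤ b) {K : Set ℂ} (hK : IsCompact K)
    (hKS : Disjoint K (realSeg a b)) :
    ∃ C δ₀ : ℝ, 0 < δ₀ ∧ 2 * δ₀ < a ∧ ∀ δ (hδ : 0 < δ) (hδa : 2 * δ < a), δ < δ₀ → ∀ z ∈ K,
      ‖(isSlitHull_stadium hab hδ hδa).ext z - z‖ ≤ C * δ := by
  -- a positive lower bound `m` for `infDist` on `K`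
  obtain ⟨m, hm0, hm⟩ : ∃ m > 0, ∀ z ∈ K, m ≤ infDist z (realSeg a b) := by
    rcases K.eq_empty_or_nonempty with hKe | hKne
    · exact ⟨1, one_pos, by simp [hKe]⟩
    obtain ⟨z₀, hz₀, hmin⟩ := hK.exists_isMinOn hKne (continuous_infDist_pt (realSeg a b)).continuousOn
    refine ⟨infDist z₀ (realSeg a b), ?_, fun z hz ↦ hmin hz⟩
    have hz₀S : z₀ ∉ realSeg a b := fun h ↦ Set.disjoint_left.1 hKS hz₀ h
    exact (isCompact_realSeg.isClosed.notMem_iff_infDist_pos (realSeg_nonempty a b)).1 hz₀S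
  set η : ℝ := min (m / 2) (a / 2) with hη
  have hη0 : 0 < η := by rw [hη]; positivity
  have hηm : η < m := by have := min_le_left (m / 2) (a / 2); rw [hη]; linarith
  have hηa : η < a := by have := min_le_right (m / 2) (a / 2); rw [hη]; linarith
  set s : Set ℂ := {z : ℂ | η < infDist z (realSeg a b)} with hs
  have hso : IsOpen s := isOpen_lt continuous_const (continuous_infDist_pt _)
  have hsc : IsPreconnected s := (isPathConnected_setOf_lt_infDist_realSeg hab hη0.le).isConnected.isPreconnected
  have h0s : (0 : ℂ) ∈ s := by
    show η < infDist 0 (realSeg a b)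
    exact hηa.trans_le (le_infDist_zero_realSeg ha.le hab)
  have hKs : K ⊆ s := fun z hz ↦ hηm.trans_le (hm z hz)
  -- the family
  set δ₀ : ℝ := η / 2 with hδ₀
  have hδ₀0 : 0 < δ₀ := by positivity
  have hδ₀a : 2 * δ₀ < a := by rw [hδ₀]; linarith
  set ι := {δ : ℝ // 0 < δ ∧ δ < δ₀}
  have hι : ∀ i : ι, 2 * i.1 < a := fun i ↦ by linarith [i.2.2]
  have hD : ∀ i : ι, IsSlitHull (stadium a b i.1) (a - 2 * i.1) (b + i.1) := fun i ↦
    isSlitHull_stadium hab i.2.1 (hι i)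
  have hδ₀η : δ₀ = η / 2 := rfl
  have hsmall : ∀ i : ι, 2 * i.1 < η := fun i ↦ by
    have h1 : i.1 < δ₀ := i.2.2
    linarith
  have hsΩ : ∀ i : ι, s ⊆ slitDomain (stadium a b i.1) (a - 2 * i.1) (b + i.1) := fun i z hz ↦
    mem_slitDomain_stadium hab i.2.1 (hι i) ((hsmall i).trans hz)
  set G : ι → ℂ → ℂ := fun i z ↦ (hD i).ext z - z with hG
  have hGd : ∀ i, DifferentiableOn ℂ (G i) s := fun i ↦
    ((hD i).differentiableOn_ext.mono (hsΩ i)).sub differentiableOn_id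
  have hG0 : ∀ i, G i 0 = 0 := fun i ↦ by simp [hG, (hD i).ext_zero]
  -- `|im G| ≤ δ` on `s`
  have him_upper : ∀ i : ι, ∀ z ∈ s, 0 < z.im → |(G i z).im| ≤ i.1 := fun i z hz hzim ↦ by
    have hzD : z ∈ upperHalfPlaneSet \ stadium a b i.1 := by
      refine ⟨hzim, fun hzD ↦ ?_⟩
      have h1 : η < infDist z (realSeg a b) := hz
      linarith [hzD.2, hsmall i, i.2.1]
    obtain ⟨L, hL⟩ := (hD i).exists_tendsto_ext_sub
    have h1 := (hD i).im_ext_le_im hL hzD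
    have h2 := (hD i).im_sub_height_le_im_ext i.2.1.le (fun w hw ↦ im_le_of_mem_stadium hw) hzD
    rw [hG, sub_im, abs_le]
    exact ⟨by linarith, by linarith⟩
  have him : ∀ i, ∀ z ∈ s, |(G i z).im| ≤ i.1 := fun i z hz ↦ by
    rcases lt_trichotomy z.im 0 with hlt | heq | hgt
    · have hcz : conj z ∈ s := by show η < _; rw [infDist_conj_realSeg]; exact hz
      have h1 := him_upper i (conj z) hcz (by rw [conj_im]; linarith)
      have h2 : G i (conj z) = conj (G i z) := by
        simp only [hG, (hD i).ext_conj (hsΩ i hz), map_sub]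
      rwa [h2, conj_im, abs_neg] at h1
    · have hzre : ((z.re : ℝ) : ℂ) = z := Complex.ext (by simp) (by simp [heq])
      have : (G i z).im = 0 := by
        rw [hG]
        simp only [sub_im, heq, sub_zero]
        rw [← hzre]
        exact (hD i).ext_ofReal_im (by rw [hzre]; exact hsΩ i hz)
      rw [this, abs_zero]
      exact i.2.1.le
    · exact him_upper i z hz hgt
  obtain ⟨C, hC⟩ := exists_forall_norm_le_mul_of_abs_im_le hso hsc (fun i : ι ↦ i.2.1) hGd him h0s hG0 hK hKs
  refine ⟨C, δ₀, hδ₀0, hδ₀a, fun δ hδ hδa hδδ₀ z hz ↦ ?_⟩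
  exact hC ⟨δ, hδ, hδδ₀⟩ z hz

end Stadium

end Literature.Probability.RandomPlanarGeometry
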